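import Summits.BirchSwinnertonDyer.BirchSwinnertonDyer.Theorems.SemiOrdinaryEisensteinDescentWildKolyvaginUpperAtThreePrintClosedSubcells
import HarnessLib

/-!
# Route `SemiOrdinaryEisensteinDescent`, crux Ko′ `WildKolyvaginUpperAtThreeTowerFree` (stmt-BirchSwinnertonDyer-24696,
# rev 12–15: Ko stmt-20480 minus the `3`-adic tower binder): Ko′ BY NAME from the four primitives and the Σ-form J′
# asked ONLY on its honest residue (cell `bsd-wall`, width seat `bsd-wall-soed-p2-w2` gen 4; `--supports stmt-…-24696`)

The pen (pss3x g2, act F) superseded Ko by the TOWER-FREE crux Ko′ (split: CT 20191 ∧ 3.7(2) 23091 ∧ E0 24701 ∧ J′ 24702,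
glue 24703 = p594241). This file transports the print-closed sub-cells of Ko (p597487,
`…WildKolyvaginUpperAtThreePrintClosedSubcells`) to Ko′ and records EXACTLY which frames of Ko′ still need the research
child J′ = `WildSigmaDivisibilityAtThreeTowerFree` (stmt-BirchSwinnertonDyer-24702). Write `t := ord₃ ∏_q c_q(E) + v₃ c(Dt)`.

* §1 `wildKolyvaginUpperAtThreeTowerFree_of_sigmaOnResidue_of_fourPrimitives` — **Ko′ BY NAME ⟸ {CT, 3.7(2), E0, PT} +
  J′ restricted to its RESIDUE**: `hJr` is J′'s text VERBATIM with TWO extra binders, «`0 < t`» and «if the `3`-adic tower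
  IS surjective then no single prime `q ∣ N` carries the depth (`∀ q ∣ N, ord₃ c_q(E) < t`)». Every other Ko′-frame is
  print-closed: `t = 0` by `koTowerFree_of_depthZero_of_threePrimitives` (three primitives, no tower), single-carrier
  frames ON the tower by `ko_of_singleCarrier_of_fourPrimitives` (Jetchev's Thm. 1.4 at `3 ∣ N`,
  `SchneiderFree.Exact.jetchevMaxAtThree_of_literature`, whose `bsd-jet` kernel carries the tower as a binder). So the
  residue of Ko′ is {multi-carrier frames} ∪ {off-tower frames with `t ≥ 1`} — the second piece (habitat: the 39
  onto-3/not-onto-9 `r_an = 1` classes of Elkies' defect, census) is print-closable on its single-carrier part once the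
  `bsd-jet` reading binders `JET.JetchevDivisibilityCarrier{Ne,Mult,Add}` are weakened from the tower to `ρ̄₃` onto (the
  kernel uses `htower 1` only — audit `Cruxes/WildKolyvaginUpperAtThree/SUBCELLS-JET-TOWER-w2g4.md` §2); §2 states that
  target shape.
* §2 `wildKolyvaginUpperAtThreeTowerFree_of_sigmaMultiCarrier_of_jetchevMaxModThree_of_threePrimitives` — **Ko′ BY NAME
  ⟸ {CT, 3.7(2), E0} + [Jetchev's max-form at `3 ∣ N` under `ρ̄₃` onto ONLY, displayed as hypothesis `hJmax`] + J′
  restricted to MULTI-CARRIER frames** (`hJm`: J′'s text + «`∀ q ∣ N, ord₃ c_q(E) < t`»). `hJmax` is exactly the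
  conclusion shape of `jetchevMaxAtThree_of_literature` with its `TowerSurjThree W` binder deleted: print (Jetchev 2008
  §§4–6 via (PT), (F1), (3.7)) modulo the mechanical binder weakening of the `bsd-jet` files; NOT a new claim.

HONEST FRAMING. CONDITIONAL theorems: the primitives are Literature named facts (hypotheses); `hJr` / `hJm` are open research
(Jetchev 2008 Conj. 1.3 «≥» at the additive prime `3` on multi-carrier frames = Büyükboduk 2009 §4.2 Question 1 ⊕ Manin₃;
plus, in §1, the off-tower single-carrier frames pending the `bsd-jet` refactor); `hJmax` in §2 is print modulo that
refactor. Nothing about any curve is asserted; no definition, no named fact, no `sorry`; Ko′, J′ and BSD stay open.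
BSD is not proved by this file.

References: [Jetchev2008] Thm. 1.4, Cor. 1.5, Conj. 1.3 (arXiv:math/0703431 p. 3); [McCallumLMS1991] §3, §5 Cor. 5.6
(p. 310); [Cha2005] Thm. 3, Thm. 7; [Elkies2006]; [Buyukboduk2009TamagawaDefect] §4.2 Question 1; [GrossLMS1991]
Prop. 3.7 (2), §6; [MilneADT2006] I Thm. 4.10, §6 Thm. 6.13.
-/

set_option autoImplicit false
set_option linter.dupNamespace false -- `Summit.BirchSwinnertonDyer.BirchSwinnertonDyer.…` is the tree's layout (D-0017)

noncomputable section

open scoped Classical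

namespace Summit.BirchSwinnertonDyer.BirchSwinnertonDyer.Theorems.WildKolyvaginUpperAtThreeTowerFreePrintClosedSubcells

open WeierstrassCurve NumberField
  Literature.NumberTheory.EllipticCurves
  Literature.NumberTheory.EllipticCurves.ModularForms
  Literature.NumberTheory.GaloisCohomology
  Summit.BirchSwinnertonDyer.Rank1Residual
  Summit.BirchSwinnertonDyer.Rank1Residual.Additive
  Summit.BirchSwinnertonDyer.Rank1Residual.X11b.Three
  Summit.BirchSwinnertonDyer.BirchSwinnertonDyer.Theses.SemiOrdinaryEisensteinDescent
  Summit.BirchSwinnertonDyer.BirchSwinnertonDyer.Theorems.SchneiderFree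
  Summit.BirchSwinnertonDyer.BirchSwinnertonDyer.Theorems.WildKolyvaginUpperAtThreeTowerFree
  Summit.BirchSwinnertonDyer.BirchSwinnertonDyer.Theorems.WildKolyvaginUpperAtThreePrintClosedSubcells
open Literature.NumberTheory.EllipticCurves.GrossLMS1991 (prop37_2_frobeniusCongruence)

/-! ## §1 Ko′ BY NAME ⟸ the four primitives + J′ on its residue {multi-carrier} ∪ {off-tower, `t ≥ 1`} -/

/-- **Ko′ BY NAME from the four primitives and J′ restricted to its residue.** `hJr` is the text of J′ =
`WildSigmaDivisibilityAtThreeTowerFree` (stmt-BirchSwinnertonDyer-24702) VERBATIM with two extra binders inserted after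
`d_K ≠ −3`: `0 < t` (`t := ord₃ ∏ c_q(E) + v₃ c(Dt)`) and `TowerSurjThree W → ∀ q ∣ N, ord₃ c_q(E) < t` (on the tower,
no single carrier). Every other frame of Ko′: `t = 0` — `koTowerFree_of_depthZero_of_threePrimitives` ({CT, 3.7, E0}, no
tower); single-carrier ON the tower — `ko_of_singleCarrier_of_fourPrimitives` ({CT, 3.7, E0, PT}, Jetchev Thm. 1.4 at
`3 ∣ N`). CONDITIONAL on the four named facts and on `hJr` (open research); Ko′, J′ and BSD stay open.
[cite: Jetchev2008, Thm. 1.4 and Conj. 1.3 (arXiv:math/0703431 p. 3)] [cite: McCallumLMS1991, §5 Cor. 5.6 (p. 310)]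
[cite: Buyukboduk2009TamagawaDefect, §4.2 Question 1] -/
theorem wildKolyvaginUpperAtThreeTowerFree_of_sigmaOnResidue_of_fourPrimitives
    (hCT : ∀ (K : Type) [Field K] [NumberField K], casselsTate_levelInputs K)
    (h372 : prop37_2_frobeniusCongruence) (hE0 : Gross1991_heegnerPoint_sub_ratTorsion_mem_E0)
    (hPT : ∀ (K : Type) [Field K] [NumberField K], poitouTate_selmerStructure_duality_conj K)
    (hJr : ∀ (W : WeierstrassCurve ℚ) [W.IsElliptic] [W.IsGloballyMinimal] (N : ℕ) [NeZero N] (K : Type)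
      [Field K] [NumberField K] (Dt : ModularParametrizationData W N)
      (H : HeegnerDatum N (NumberField.discr K)) (ι : K →+* ℂ) (P : (W.baseChange K).toAffine.Point),
      ClassO6 W 3 → W.HasSurjectiveModNGaloisRep 3 → W.analyticRank = 1 → W.conductorNorm ℤ = N →
      IsImaginaryQuadratic K → SatisfiesHeegnerHypothesis N K →
      (W.quadraticTwist (NumberField.discr K : ℚ)).entireLFunction 1 ≠ 0 →
      WeierstrassCurve.Affine.Point.map ι.toRatAlgHom P = heegnerPointComplex Dt H →
      ¬ IsOfFinAddOrder P → Odd (NumberField.discr K) → NumberField.discr K ≠ -3 →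
      0 < padicValNat 3 W.tamagawaProduct + padicValNat 3 Dt.c.natAbs →
      (AdditiveThree.TowerSurjThree W → ∀ (q : ℕ) [Fact q.Prime], q ∣ N →
        padicValNat 3 ((W.baseChange ℚ_[q]).localTamagawaNumber ℤ_[q]) <
          padicValNat 3 W.tamagawaProduct + padicValNat 3 Dt.c.natAbs) →
      ∀ (s' : ℕ), s' ≤ padicValNat 3 W.tamagawaProduct + padicValNat 3 Dt.c.natAbs →
        ∀ (n : ℕ) (d : KolyvaginHeegnerData Dt H.β ι n), Squarefree n →
          (∀ ℓ ∈ n.primeFactors, Zhang2014.IsKolyvaginPrime N W K 3 ℓ ∧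
            s' ≤ Zhang2014.kolyvaginIndex W 3 ℓ) → Koly.PDiv d 3 s') :
    WildKolyvaginUpperAtThreeTowerFree := by
  intro W _ _ N _ K _ _ Dt H ι P hO6 hsurj hr hN hK hHH hLd hP hnt hodd h3
  -- zero depth: three primitives, no tower, no J′
  by_cases ht : padicValNat 3 W.tamagawaProduct + padicValNat 3 Dt.c.natAbs = 0
  · exact koTowerFree_of_depthZero_of_threePrimitives hCT h372 hE0 W N K Dt H ι P hsurj hN hK hHH hP hnt hodd h3 ht
  have htpos : 0 < padicValNat 3 W.tamagawaProduct + padicValNat 3 Dt.c.natAbs := Nat.pos_of_ne_zero ht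
  -- single carrier ON the tower: Jetchev's Thm. 1.4 at `3 ∣ N` + the four primitives
  by_cases hsingle : AdditiveThree.TowerSurjThree W ∧ ¬ ∀ (q : ℕ) [Fact q.Prime], q ∣ N →
      padicValNat 3 ((W.baseChange ℚ_[q]).localTamagawaNumber ℤ_[q]) <
        padicValNat 3 W.tamagawaProduct + padicValNat 3 Dt.c.natAbs
  · obtain ⟨htow, hm⟩ := hsingle
    push Not at hm
    obtain ⟨q₀, hq₀, hq₀N, hcar⟩ := hm
    exact ko_of_singleCarrier_of_fourPrimitives hCT h372 hE0 hPT W N K Dt H ι P hO6 hsurj hr hN hK hHH hLd hP hnt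
      hodd h3 htow hq₀N hcar
  -- the residue: multi-carrier on the tower, or off the tower — J′ feeds the three-primitive receptacle
  have hres : AdditiveThree.TowerSurjThree W → ∀ (q : ℕ) [Fact q.Prime], q ∣ N →
      padicValNat 3 ((W.baseChange ℚ_[q]).localTamagawaNumber ℤ_[q]) <
        padicValNat 3 W.tamagawaProduct + padicValNat 3 Dt.c.natAbs := by
    intro htow
    by_contra hm
    exact hsingle ⟨htow, hm⟩
  have hglob := hJr W N K Dt H ι P hO6 hsurj hr hN hK hHH hLd hP hnt hodd h3 htpos hres
  subst hN
  haveI : Fact (Nat.Prime 3) := ⟨Nat.prime_three⟩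
  have hD : NumberField.discr K < -4 :=
    WildKolyvaginUpperAtThreeOfMinftyGe.discr_lt_neg_four_of_odd hK hodd h3 H.dvd_sq_sub
  have h4 : NumberField.discr K ≠ -4 := by omega
  exact upper_of_globalDivisibility_of_threePrimitives_modP hCT h372 hE0 W 3 (by decide) hsurj K hK h3 h4 hHH
    Dt H ι P hP hnt hglob

/-! ## §2 The target shape after the `bsd-jet` binder weakening: residue = multi-carrier frames only -/

/-- **Ko′ BY NAME ⟸ {CT, 3.7(2), E0} + Jetchev's max-form at `3 ∣ N` under `ρ̄₃` onto ONLY (displayed, `hJmax`) + J′ on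
MULTI-CARRIER frames (`hJm`).** `hJmax` is the conclusion shape of `SchneiderFree.Exact.jetchevMaxAtThree_of_literature`
with the `TowerSurjThree W` binder deleted (the `bsd-jet` road-K kernel consumes the tower only as `htower 1`; pending the
mechanical weakening of the reading binders `JET.JetchevDivisibilityCarrier{Ne,Mult,Add}` it is displayed here, not
derived); `hJm` is J′'s text with ONE extra binder «`∀ q ∣ N, ord₃ c_q(E) < t`». CONDITIONAL on the three named facts, on
`hJmax` (print modulo that refactor) and on `hJm` (open research); Ko′, J′ and BSD stay open.
[cite: Jetchev2008, Thm. 1.4 and Conj. 1.3 (arXiv:math/0703431 p. 3)] [cite: Cha2005, Thm. 3 and Thm. 7]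
[cite: McCallumLMS1991, §3 and §5 Cor. 5.6 (p. 310)] -/
theorem wildKolyvaginUpperAtThreeTowerFree_of_sigmaMultiCarrier_of_jetchevMaxModThree_of_threePrimitives
    (hCT : ∀ (K : Type) [Field K] [NumberField K], casselsTate_levelInputs K)
    (h372 : prop37_2_frobeniusCongruence) (hE0 : Gross1991_heegnerPoint_sub_ratTorsion_mem_E0)
    (hJmax : ∀ (W : WeierstrassCurve ℚ) [W.IsElliptic] [W.IsGloballyMinimal] (N : ℕ) [NeZero N] (K : Type)
      [Field K] [NumberField K] (Dt : ModularParametrizationData W N)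
      (H : HeegnerDatum N (NumberField.discr K)) (ι : K →+* ℂ) (P : (W.baseChange K).toAffine.Point),
      ClassO6 W 3 → W.HasSurjectiveModNGaloisRep 3 → W.analyticRank = 1 → W.conductorNorm ℤ = N →
      IsImaginaryQuadratic K → SatisfiesHeegnerHypothesis N K →
      (W.quadraticTwist (NumberField.discr K : ℚ)).entireLFunction 1 ≠ 0 →
      WeierstrassCurve.Affine.Point.map ι.toRatAlgHom P = heegnerPointComplex Dt H →
      ¬ IsOfFinAddOrder P → Odd (NumberField.discr K) → NumberField.discr K ≠ -3 →
      ∀ (q : ℕ) [Fact q.Prime], q ∣ N →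
      ∀ (s' : ℕ), s' ≤ padicValNat 3 ((W.baseChange ℚ_[q]).localTamagawaNumber ℤ_[q]) →
        ∀ (n : ℕ) (d : KolyvaginHeegnerData Dt H.β ι n), Squarefree n →
          (∀ ℓ ∈ n.primeFactors, Zhang2014.IsKolyvaginPrime N W K 3 ℓ ∧
            s' ≤ Zhang2014.kolyvaginIndex W 3 ℓ) → Koly.PDiv d 3 s')
    (hJm : ∀ (W : WeierstrassCurve ℚ) [W.IsElliptic] [W.IsGloballyMinimal] (N : ℕ) [NeZero N] (K : Type)
      [Field K] [NumberField K] (Dt : ModularParametrizationData W N)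
      (H : HeegnerDatum N (NumberField.discr K)) (ι : K →+* ℂ) (P : (W.baseChange K).toAffine.Point),
      ClassO6 W 3 → W.HasSurjectiveModNGaloisRep 3 → W.analyticRank = 1 → W.conductorNorm ℤ = N →
      IsImaginaryQuadratic K → SatisfiesHeegnerHypothesis N K →
      (W.quadraticTwist (NumberField.discr K : ℚ)).entireLFunction 1 ≠ 0 →
      WeierstrassCurve.Affine.Point.map ι.toRatAlgHom P = heegnerPointComplex Dt H →
      ¬ IsOfFinAddOrder P → Odd (NumberField.discr K) → NumberField.discr K ≠ -3 →
      (∀ (q : ℕ) [Fact q.Prime], q ∣ N →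
        padicValNat 3 ((W.baseChange ℚ_[q]).localTamagawaNumber ℤ_[q]) <
          padicValNat 3 W.tamagawaProduct + padicValNat 3 Dt.c.natAbs) →
      ∀ (s' : ℕ), s' ≤ padicValNat 3 W.tamagawaProduct + padicValNat 3 Dt.c.natAbs →
        ∀ (n : ℕ) (d : KolyvaginHeegnerData Dt H.β ι n), Squarefree n →
          (∀ ℓ ∈ n.primeFactors, Zhang2014.IsKolyvaginPrime N W K 3 ℓ ∧
            s' ≤ Zhang2014.kolyvaginIndex W 3 ℓ) → Koly.PDiv d 3 s') :
    WildKolyvaginUpperAtThreeTowerFree := by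
  intro W _ _ N _ K _ _ Dt H ι P hO6 hsurj hr hN hK hHH hLd hP hnt hodd h3
  -- the global divisibility to depth `t` on this frame, by cases on the carriers
  have hglob : ∀ (s' : ℕ), s' ≤ padicValNat 3 W.tamagawaProduct + padicValNat 3 Dt.c.natAbs →
      ∀ (n : ℕ) (d : KolyvaginHeegnerData Dt H.β ι n), Squarefree n →
        (∀ ℓ ∈ n.primeFactors, Zhang2014.IsKolyvaginPrime N W K 3 ℓ ∧
          s' ≤ Zhang2014.kolyvaginIndex W 3 ℓ) → Koly.PDiv d 3 s' := by
    by_cases hm : ∀ (q : ℕ) [Fact q.Prime], q ∣ N →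
        padicValNat 3 ((W.baseChange ℚ_[q]).localTamagawaNumber ℤ_[q]) <
          padicValNat 3 W.tamagawaProduct + padicValNat 3 Dt.c.natAbs
    · exact hJm W N K Dt H ι P hO6 hsurj hr hN hK hHH hLd hP hnt hodd h3 hm
    · push Not at hm
      obtain ⟨q₀, hq₀, hq₀N, hcar⟩ := hm
      intro s' hs' n d hn hℓ
      exact hJmax W N K Dt H ι P hO6 hsurj hr hN hK hHH hLd hP hnt hodd h3 q₀ hq₀N s' (hs'.trans hcar) n d hn hℓ
  subst hN
  haveI : Fact (Nat.Prime 3) := ⟨Nat.prime_three⟩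
  have hD : NumberField.discr K < -4 :=
    WildKolyvaginUpperAtThreeOfMinftyGe.discr_lt_neg_four_of_odd hK hodd h3 H.dvd_sq_sub
  have h4 : NumberField.discr K ≠ -4 := by omega
  exact upper_of_globalDivisibility_of_threePrimitives_modP hCT h372 hE0 W 3 (by decide) hsurj K hK h3 h4 hHH
    Dt H ι P hP hnt hglob

end Summit.BirchSwinnertonDyer.BirchSwinnertonDyer.Theorems.WildKolyvaginUpperAtThreeTowerFreePrintClosedSubcells

end
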